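import Mathlib.Analysis.SpecificLimits.Normed

/-!
# `BalabanUV.Beta.GAN24.LegWindowArithmetic` — binder row G-an2-4 ∕ (CONV-C), W-slot, the (α-0) parity re-cut, located crux (Q-L-k₀)
# (RULING R-gan24p1-g36-1 (3) + (5): «the rate∕k₀ arithmetic»): **THE WINDOW LENGTH AND THE RATE CAN BE CHOSEN** — for any amplitude constant `c`, any
# polynomial degree `p`, any minimal length, any leg rate `κ₀ > 0` and any rate ceiling `δ₀ > 0`, there are a window length `k₀` and a rate `δ` with
# `0 < δ ≤ δ₀`, `P·δ ≤ κ₀` (the packaging condition, any `P > 0`), `Q·κ₀ ≤ δ·Lc^{k₀}` (the transfer gap of leaf-01 g74's core, any `Q`) and `c·k₀^p·(Lc⁻¹)^{k₀} < 1`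
# (the contraction factor) (OWNER `b2b-balaban-gan24-p1`, gen 36)

NOT IN PRINT; OUR BOOKKEEPING ([folklore] real analysis: a polynomial times a geometric sequence tends to zero; 0 `def`, 0 cited facts, 0 `def … : Prop`, 0 sorry;
imports `Mathlib.Analysis.SpecificLimits.Normed` only).  HONEST FRAMING (cell contract, verbatim): «discharging `BetaPertH` makes Bałaban's UV stability UNCONDITIONAL — a real constructive-QFT
result; it is NOT the continuum limit and NOT the Clay problem.»  HONEST DEPENDENCY (verbatim): «continuum YM on T⁴ ⇐ BetaPertH ∧ nine spine estimates (0/9 proved);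
BetaPertH ⇐ (D1) ∧ (D4) ∧ CAP+tail; G-an2-4 gates asym, D1 and NE2/3/4.»

WHY.  RULING R-gan24p1-g36-1 re-locates (H1♮) as leaf-01 g74's double-freezing core (`ThreeLegDoubleFreeze`, hypothesis `κ₀ ≤ (δ∕6)·L`, `L = Lc^{k₀}`,
output packaged at rate `κ₀∕(6(d+1))` and weakened to the socket's `δ`) with a contraction factor of the shape `θ(k₀) = c·(1 + c′k₀)·Lc^{−k₀}` (the dressed
kernel leg costs a `k₀`-linear constant, `DressedLegBlockL1Envelope`); the (Q-L) END (`LegTowerMemberRows` ∕ `LegRowsOnRuledClass`) wants `0 ≤ θ < 1` and ONE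
rate `δ` at which (H0)∕(H2) also hold (`LegFirstWindowRows`: every `δ ≤ δ₀`).  This file is the one-line answer «choose `δ` first, then `k₀` large».
WHAT (pure arithmetic; `2 ≤ Lc`):
* `tendsto_mul_pow_mul_inv_pow` — `c·k^p·(Lc⁻¹)^k → 0`; `eventually_contraction_lt_one`; `eventually_gap` (`Q·κ₀ ≤ δ·Lc^k` eventually);
* **`exists_window_and_rate`** — `∃ k₀ δ, kmin ≤ k₀ ∧ 0 < δ ∧ δ ≤ δ₀ ∧ P·δ ≤ κ₀ ∧ Q·κ₀ ≤ δ·Lc^{k₀} ∧ c·k₀^p·(Lc⁻¹)^{k₀} < 1`; `exists_window_and_rate_six` (`P = 6(d+1)`, `Q = 6`).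
Asserts NOTHING about Bałaban's tables; NOT (H1♮); NEVER «G-an2-4 closed» as (CONV-C); NOT D1, NOT `BetaPertH`, NOT continuum, NOT Clay.  2026-08-23.
-/

open Filter Topology

namespace Summit.QuantumFields.BalabanUV.Beta.GAN24.LegWindowArithmetic

/-- [folklore] A polynomial times a geometric sequence of ratio `Lc⁻¹ < 1` tends to zero: `c·k^p·(Lc⁻¹)^k → 0` (`2 ≤ Lc`). -/
theorem tendsto_mul_pow_mul_inv_pow {Lc : ℕ} (hLc : 2 ≤ Lc) (c : ℝ) (p : ℕ) :
    Tendsto (fun k : ℕ => c * (k : ℝ) ^ p * ((Lc : ℝ)⁻¹) ^ k) atTop (𝓝 0) := by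
  have hL : (2 : ℝ) ≤ Lc := by exact_mod_cast hLc
  have hr : |((Lc : ℝ)⁻¹)| < 1 := by
    rw [abs_of_pos (by positivity)]
    exact inv_lt_one_of_one_lt₀ (by linarith)
  have h := (tendsto_pow_const_mul_const_pow_of_abs_lt_one p hr).const_mul c
  rw [mul_zero] at h
  refine h.congr fun k => ?_
  ring

/-- [folklore] Hence the contraction factor is eventually below one: `∀ᶠ k, c·k^p·(Lc⁻¹)^k < 1`. -/
theorem eventually_contraction_lt_one {Lc : ℕ} (hLc : 2 ≤ Lc) (c : ℝ) (p : ℕ) :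
    ∀ᶠ k : ℕ in atTop, c * (k : ℝ) ^ p * ((Lc : ℝ)⁻¹) ^ k < 1 :=
  (tendsto_mul_pow_mul_inv_pow hLc c p).eventually (gt_mem_nhds zero_lt_one)

/-- [folklore] The transfer gap is eventually available: for `δ > 0` and any `Q`, `∀ᶠ k, Q·κ₀ ≤ δ·Lc^k` (`2 ≤ Lc`). -/
theorem eventually_gap {Lc : ℕ} (hLc : 2 ≤ Lc) (Q κ₀ : ℝ) {δ : ℝ} (hδ : 0 < δ) :
    ∀ᶠ k : ℕ in atTop, Q * κ₀ ≤ δ * (Lc : ℝ) ^ k := by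
  have hL : (1 : ℝ) < Lc := by exact_mod_cast (lt_of_lt_of_le (by norm_num) hLc)
  have h : Tendsto (fun k : ℕ => δ * (Lc : ℝ) ^ k) atTop atTop :=
    (tendsto_pow_atTop_atTop_of_one_lt hL).const_mul_atTop hδ
  exact h.eventually_ge_atTop (Q * κ₀)

/-- NOT IN PRINT; OUR BOOKKEEPING.  **THE WINDOW LENGTH AND THE RATE CAN BE CHOSEN** (RULING R-gan24p1-g36-1 (3)+(5), «the rate∕k₀ arithmetic»): for
`2 ≤ Lc`, `0 < κ₀`, `0 < δ₀`, a packaging constant `P > 0` (the END's `6(d+1)`, or `18(d+1)` after leaf-01's bond symmetrisation), any gap constant `Q`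
(the core's `6`), any `c`, `p`, `kmin`:
`∃ k₀ δ, kmin ≤ k₀ ∧ 0 < δ ∧ δ ≤ δ₀ ∧ P·δ ≤ κ₀ ∧ Q·κ₀ ≤ δ·Lc^{k₀} ∧ c·k₀^p·(Lc⁻¹)^{k₀} < 1`
— `δ := min δ₀ (κ₀ ∕ P)`, then `k₀` large along `atTop`. -/
theorem exists_window_and_rate {Lc : ℕ} (hLc : 2 ≤ Lc) {κ₀ δ₀ P : ℝ} (hκ₀ : 0 < κ₀) (hδ₀ : 0 < δ₀) (hP : 0 < P) (Q c : ℝ) (p kmin : ℕ) :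
    ∃ k₀ : ℕ, ∃ δ : ℝ, kmin ≤ k₀ ∧ 0 < δ ∧ δ ≤ δ₀ ∧ P * δ ≤ κ₀ ∧ Q * κ₀ ≤ δ * (Lc : ℝ) ^ k₀ ∧
      c * (k₀ : ℝ) ^ p * ((Lc : ℝ)⁻¹) ^ k₀ < 1 := by
  set δ : ℝ := min δ₀ (κ₀ / P) with hδdef
  have hδ0 : 0 < δ := lt_min hδ₀ (div_pos hκ₀ hP)
  have hδ₁ : δ ≤ δ₀ := min_le_left _ _
  have hδ₂ : P * δ ≤ κ₀ := by
    have h := min_le_right δ₀ (κ₀ / P)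
    rw [← hδdef] at h
    calc P * δ ≤ P * (κ₀ / P) := mul_le_mul_of_nonneg_left h hP.le
      _ = κ₀ := by field_simp
  have hev := ((eventually_contraction_lt_one hLc c p).and (eventually_gap hLc Q κ₀ hδ0)).and (eventually_ge_atTop kmin)
  obtain ⟨k₀, ⟨⟨h1, h2⟩, h3⟩⟩ := hev.exists
  exact ⟨k₀, δ, h3, hδ0, hδ₁, hδ₂, h2, h1⟩

/-- [folklore] THE INSTANCE WITH THE RULING's CONSTANTS (`P = 6(d+1)`, `Q = 6`): `∃ k₀ δ, kmin ≤ k₀ ∧ 0 < δ ∧ δ ≤ δ₀ ∧ 6(d+1)·δ ≤ κ₀ ∧ 6κ₀ ≤ δ·Lc^{k₀} ∧ c·k₀^p·(Lc⁻¹)^{k₀} < 1`. -/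
theorem exists_window_and_rate_six {Lc : ℕ} (hLc : 2 ≤ Lc) (d : ℕ) {κ₀ δ₀ : ℝ} (hκ₀ : 0 < κ₀) (hδ₀ : 0 < δ₀) (c : ℝ) (p kmin : ℕ) :
    ∃ k₀ : ℕ, ∃ δ : ℝ, kmin ≤ k₀ ∧ 0 < δ ∧ δ ≤ δ₀ ∧ 6 * ((d : ℝ) + 1) * δ ≤ κ₀ ∧ 6 * κ₀ ≤ δ * (Lc : ℝ) ^ k₀ ∧
      c * (k₀ : ℝ) ^ p * ((Lc : ℝ)⁻¹) ^ k₀ < 1 :=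
  exists_window_and_rate hLc hκ₀ hδ₀ (by positivity) 6 c p kmin

end Summit.QuantumFields.BalabanUV.Beta.GAN24.LegWindowArithmetic
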